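import Summits.ResolutionOfSingularities.ResolutionOfSingularities.Theorems.JetCutTameKernels2
import Summits.ResolutionOfSingularities.ResolutionOfSingularities.Theorems.JetCutVastKernels
import Summits.ResolutionOfSingularities.ResolutionOfSingularities.Theorems.MaxContactCutPinchCut
import HarnessLib

/-!
# MaxContactCutJetCut — the decomp-res node «JetCut» BY NAME on the host route `MaxContactCut` (lens-2 g15 rev 5,
pin 9f53e5ca), wiring file 1/2

Content VERBATIM from the decomp-res lens-2 file `HOME/decomp-res-lens-2/g15/JetCut.lean` rev 5 (pin 9f53e5ca =
`parts/JetCut-rev5-9f53e5ca.lean`, 7 495 l;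
HOME = run/shared/lean/pub/decomp-res; CRITIC-LEDGER rows 109 / 115 / 120 / 121 / 122 / 127 / 133 CLEARED; landing
order INBOX :231; the critic's
HYGIENE-landing.md h1–h11 applied — DOCSTRING-ONLY).  The lens's blocks RESTATED VERBATIM from lens-2 g12 / g13 /
g14 (§R / §R13 / §R14) are DELETED:
they are the tree's `RelativeDeltaCut*` / `CurveLeafExit*` / `PinchCut*` modules (namespaces `RelativeDeltaCut`,
`CurveLeafExit`, `PinchCut`, opened;
the lens's `CurveLeafExitRestated.x` / `PinchCutRestated.x` are cited as `CurveLeafExit.x` / `PinchCut.x`, the three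
pointwise engine edges of g12 as
`RelativeDeltaCut.x`).  Namespace `…Theorems.JetCut` (the lens's `Theses.JetCut` is gate-reserved), sub-namespaces
`Tame` / `Wide` / `Broad` / `Vast`
as in the lens; file split only (tree files ≤ 400 lines): sections, variables and every declaration exactly as in
the lens, the long rev-0/1 prose
lives in HOME/decomp-res-lens-2/g15/NODE-g15.md §ARCHIVE-A (not in the tree).  Node files, in import order:
`JetCutJetKernels`, `JetCutPoint`, `JetCutClasses`, `JetCutKernels`, `JetCutTame`, `JetCutTameClasses`,
`JetCutTameKernels`, `JetCutLadder`, `JetCutWideClasses`, `JetCutWideKernels`, `JetCutMixed`, `JetCutBroadClasses`,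
`JetCutBroadKernels`, `JetCutDegenerate`, `JetCutVastClasses`, `JetCutVastKernels`
(each possibly continued `…2`, `…3`), then the wiring `MaxContactCutJetCut*` (in the Theses cone).  All `--supports
stmt-ResolutionOfSingularities-29273`
(`MaxContactCut.RungOne`); nothing closes 29273 — decided cells carry their engines as hypotheses, and exactly ONE
located-residual aside is booked on
the route for this column (`Vast.VastSpecialRung`, home `JetCutVastClasses`).

THE WIRING of the node VERBATIM, BY NAME on the host route `MaxContactCut` (in the Theses cone), in lens order: for
the jet cut and each of its mechanical copies `Tame` / `Wide` / `Broad` / `Vast` — EXACT AT THE RUNG `rungOne_iff :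
MaxContactCut.RungOne ⟺ …GenericRung ∧ …SpecialRung` (29273), necessity by letter, `closes`, `closes_of_engines` /
`closes_of_*_engines`, the cuts beneath (`…SpecialRung_iff_iso`, `closes_of_columns`, `…SpecialRung_iff_leaves`,
`closes_of_leaves`, `e_one_iff_families`), the MAP EDGES to 28544 (`closes_core`) and 30461
(`closes_closedPointCore`), and the REFINEMENT EDGES BY NAME to g14 `PinchCut.PinchGenericRung` /
`PinchSpecialRung`, g13 `CurveLeafExit.Leaf*Rung`, g12 `RelativeDeltaCut.Rel*Rung`, the tree asides 32106/32107
(g10), 31576/31577 (g9) and g11's `DeltaGenericRung` / `DeltaSpecialRung` — 0 sorry.  Imports the last route-free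
file of the node and `MaxContactCutPinchCut`.  Supports 29273.

This file carries: `rungOne_iff`, `jetGenericRung_of_rungOne`, `jetSpecialRung_of_rungOne`,
`jetSpecialRung_iff_rungOne`, `closes`, `closes_of_engines`, `closes_of_seven_engines`, `closes_of_columns`,
`closes_of_leaves`, `closes_core`, `closes_closedPointCore`, `leafGenericRung_of_jetGenericRung`,
`relGenericRung_of_jetGenericRung`, `vnGenericRung_of_jetGenericRung`, `ffGenericRung_of_jetGenericRung`,
`deltaGenericRung_of_jetGenericRung`, `jetSpecialRung_of_leafSpecialRung`, `jetSpecialRung_of_relSpecialRung`,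
`jetSpecialRung_of_vnSpecialRung`, `jetSpecialRung_of_ffSpecialRung`, `jetSpecialRung_of_deltaSpecialRung`,
`pinchSpecialRung_iff_jetSpecialRung`, `leafSpecialRung_iff_jetSpecialRung`, `relSpecialRung_iff_jetSpecialRung`,
`vnSpecialRung_iff_jetSpecialRung`, `ffSpecialRung_iff_jetSpecialRung`, `deltaSpecialRung_iff_jetSpecialRung`,
`closes_of_pinchSpecialRung`, `closes_of_leafSpecialRung`, `closes_of_vnSpecialRung`, `closes_of_ffSpecialRung`,
`closes_of_deltaSpecialRung`, `Tame.rungOne_iff`, `Tame.tameGenericRung_of_rungOne`,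
`Tame.tameSpecialRung_of_rungOne`, `Tame.tameSpecialRung_iff_rungOne`, `Tame.closes`, `Tame.closes_of_engines`,
`Tame.closes_of_seven_engines`, `Tame.closes_of_columns`, `Tame.closes_of_leaves`, `Tame.closes_core`,
`Tame.closes_closedPointCore`, `Tame.jetSpecialRung_iff_tameSpecialRung`, `Tame.closes_of_jetSpecialRung`,
`Wide.rungOne_iff`, `Wide.wideGenericRung_of_rungOne`, `Wide.wideSpecialRung_of_rungOne`,
`Wide.wideSpecialRung_iff_rungOne`, `Wide.closes`, `Wide.closes_of_engines`, `Wide.closes_of_seven_engines`,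
`Wide.closes_of_columns`, `Wide.closes_of_leaves`.

(Sources: HunekeSwanson2006 Cor. 5.5.5; CossartJannsenSaito2020 Ch. 2, Thm. 3.6/3.7, Ch. 8; CossartPiltant2008 Prop.
4.2; CossartPiltant2019 Rem. 3.2; Hironaka1964 Ch. III; Hironaka1967; Hironaka1977; Moh1987; Giraud1975.)
-/

open CategoryTheory AlgebraicGeometry TopologicalSpace IsLocalRing
open Literature.AlgebraicGeometry.Resolution
open Summit.ResolutionOfSingularities.ResolutionOfSingularities.Theorems
open Summit.ResolutionOfSingularities.ResolutionOfSingularities.Theorems.WeakOrderReduction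
open Summit.ResolutionOfSingularities.ResolutionOfSingularities.Theorems.DeltaFaceCutClasses
open Summit.ResolutionOfSingularities.ResolutionOfSingularities.Theorems.RelativeDeltaCut
open Summit.ResolutionOfSingularities.ResolutionOfSingularities.Theorems.CurveLeafExit
open Summit.ResolutionOfSingularities.ResolutionOfSingularities.Theorems.PinchCut
open Summit.ResolutionOfSingularities.ResolutionOfSingularities.Theses

namespace Summit.ResolutionOfSingularities.ResolutionOfSingularities.Theorems.JetCut

section Kernels

variable {n : ℕ}

/-- **EXACT AT THE RUNG**: `RungOne ⟺ JetGenericRung ∧ JetSpecialRung` (marking by marking). [folklore] -/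
theorem rungOne_iff : MaxContactCut.RungOne ↔ JetGenericRung ∧ JetSpecialRung := by
  constructor
  · intro h
    exact ⟨fun hE2 n hn => seqJGen_of_seqDimFour_one (h hE2 n hn),
      fun hE2 n hn => seqJSpec_of_seqDimFour_one (h hE2 n hn)⟩
  · rintro ⟨hG, hS⟩ hE2 n hn
    exact seqDimFour_one_iff.mpr ⟨hG hE2 n hn, hS hE2 n hn⟩

/-- NECESSITY by letter: the decided half is implied by the rung. [folklore] -/
theorem jetGenericRung_of_rungOne (h : MaxContactCut.RungOne) : JetGenericRung := (rungOne_iff.mp h).1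

/-- NECESSITY by letter: the located residual is implied by the rung. [folklore] -/
theorem jetSpecialRung_of_rungOne (h : MaxContactCut.RungOne) : JetSpecialRung := (rungOne_iff.mp h).2

/-- HONESTY KERNEL: modulo the decided half, the located residual IS the rung. [folklore] -/
theorem jetSpecialRung_iff_rungOne (hG : JetGenericRung) : JetSpecialRung ↔ MaxContactCut.RungOne :=
  ⟨fun hS => rungOne_iff.mpr ⟨hG, hS⟩, jetSpecialRung_of_rungOne⟩

/-- **DECIDING IMPLICATION OF THE NODE**: `MaxContactCut.RungOne` (29273) BY NAME from the two halves. [folklore] -/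
theorem closes (hG : JetGenericRung) (hS : JetSpecialRung) : MaxContactCut.RungOne :=
  rungOne_iff.mpr ⟨hG, hS⟩

/-- `RungOne` BY NAME from the eight ENGINES, the ports and the located residual. [folklore] -/
theorem closes_of_engines (hV : VeryNearCutClasses.VeryNearExit) (hD : DeltaPackageExit)
    (hU : UniformCurvePackageExit) (hR : RelCurvePackageExit) (hN : NormalConeJumpExit)
    (hM : MonomialPinchExit) (hC : FlatConeExit) (hJ : JetExit) (hP : ∀ n : ℕ, 2 ≤ n → CurvePackagePort n)
    (h1 : FaceFormCutClasses.OrderOneContact) (hS : JetSpecialRung) : MaxContactCut.RungOne :=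
  closes (jetGenericRung_of_engines hV hD hU hR hN hM hC hJ hP h1) hS

/-- **SEVEN engines suffice** — engine (J) SUBSUMES g14's engine (C) (`flatConeExit_of_jetExit`, PROVED): `RungOne` BY
NAME from `VeryNearExit`, `DeltaPackageExit`, `UniformCurvePackageExit`, `RelCurvePackageExit`, `NormalConeJumpExit`,
`MonomialPinchExit`, `JetExit`, the ports and the located residual — NO `FlatConeExit` hypothesis. [folklore] -/
theorem closes_of_seven_engines (hV : VeryNearCutClasses.VeryNearExit) (hD : DeltaPackageExit)
    (hU : UniformCurvePackageExit) (hR : RelCurvePackageExit) (hN : NormalConeJumpExit)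
    (hM : MonomialPinchExit) (hJ : JetExit) (hP : ∀ n : ℕ, 2 ≤ n → CurvePackagePort n)
    (h1 : FaceFormCutClasses.OrderOneContact) (hS : JetSpecialRung) : MaxContactCut.RungOne :=
  closes_of_engines hV hD hU hR hN hM (flatConeExit_of_jetExit hJ) hJ hP h1 hS

/-- `RungOne` BY NAME from the decided half and the two isolation columns. [folklore] -/
theorem closes_of_columns (hG : JetGenericRung) (hN : E 2 → ∀ n : ℕ, 1 ≤ n → SeqJSpecNonIso n)
    (hI : E 2 → ∀ n : ℕ, 1 ≤ n → SeqJSpecIso n) : MaxContactCut.RungOne :=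
  closes hG (jetSpecialRung_iff_iso.mpr ⟨hN, hI⟩)

/-- `RungOne` BY NAME from the decided half and the four leaves. [folklore] -/
theorem closes_of_leaves (hG : JetGenericRung) (hR : E 2 → ∀ n : ℕ, 1 ≤ n → SeqJSpecCurveReg n)
    (hS : E 2 → ∀ n : ℕ, 1 ≤ n → SeqJSpecCurveSing n) (hT : E 2 → ∀ n : ℕ, 1 ≤ n → SeqJSpecTangle n)
    (hI : E 2 → ∀ n : ℕ, 1 ≤ n → SeqJSpecIso n) : MaxContactCut.RungOne :=
  closes hG (jetSpecialRung_iff_leaves.mpr ⟨hR, hS, hT, hI⟩)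

/-! ### Map edges BY NAME to the tree's located residuals -/

/-- MAP EDGE to the located core `MaxContactCut.StepPICoreDimFour` (28544) BY NAME, through
`MaxContactCutTauLadder.closes`. [folklore] -/
theorem closes_core (h5 : MaxContactCutExhaustion.ContactOrderSequenceDimFour) (r4 : MaxContactCut.RungFour)
    (r3 : MaxContactCut.RungThree) (r2 : MaxContactCut.RungTwo) (hG : JetGenericRung) (hS : JetSpecialRung)
    (hSS : MaxContactCut.SequenceToStepAll) : MaxContactCut.StepPICoreDimFour :=
  (MaxContactCutTauLadder.closes h5 r4 r3 r2 (closes hG hS) hSS).2.2.2.2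

/-- MAP EDGE to g7's located residual `MaxContactCut.ClosedPointCoreAll` (30461) BY NAME (given the rounds, the rung IS
the closed-point core). [folklore] -/
theorem closes_closedPointCore (hE2 : E 2) (h2 : MaxContactCut.RoundCodimTwoAll)
    (h3 : MaxContactCut.RoundCodimThreeAll) (hG : JetGenericRung) (hS : JetSpecialRung) :
    MaxContactCut.ClosedPointCoreAll :=
  (MaxContactCutGenericPointCut.rungOne_iff_core_of_rounds hE2 h2 h3).mp (closes hG hS)

end Kernels

section Refinement

/-- **EDGE to g13** (through g14's edge). [folklore] -/
theorem leafGenericRung_of_jetGenericRung (h : JetGenericRung) : LeafGenericRung :=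
  PinchCut.leafGenericRung_of_pinchGenericRung (pinchGenericRung_of_jetGenericRung h)

/-- **EDGE to g12** (through g14's edge). [folklore] -/
theorem relGenericRung_of_jetGenericRung (h : JetGenericRung) : RelGenericRung :=
  PinchCut.relGenericRung_of_pinchGenericRung (pinchGenericRung_of_jetGenericRung h)

/-- **EDGE to 32106**: the decided half implies the tree's g10 decided aside `VNGenericRung`. [folklore] -/
theorem vnGenericRung_of_jetGenericRung (h : JetGenericRung) : MaxContactCut.VNGenericRung :=
  PinchCut.vnGenericRung_of_pinchGenericRung (pinchGenericRung_of_jetGenericRung h)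

/-- **EDGE to 31576** (through 32106). [folklore] -/
theorem ffGenericRung_of_jetGenericRung (h : JetGenericRung) : MaxContactCut.FFGenericRung :=
  PinchCut.ffGenericRung_of_pinchGenericRung (pinchGenericRung_of_jetGenericRung h)

/-- **EDGE to the tree's g11 rung** `DeltaFaceCutClasses.DeltaGenericRung`. [folklore] -/
theorem deltaGenericRung_of_jetGenericRung (h : JetGenericRung) : DeltaGenericRung :=
  PinchCut.deltaGenericRung_of_pinchGenericRung (pinchGenericRung_of_jetGenericRung h)

/-- **EDGE from g13** (restated). [folklore] -/
theorem jetSpecialRung_of_leafSpecialRung (h : LeafSpecialRung) : JetSpecialRung :=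
  jetSpecialRung_of_pinchSpecialRung (PinchCut.pinchSpecialRung_of_leafSpecialRung h)

/-- **EDGE from g12** (restated). [folklore] -/
theorem jetSpecialRung_of_relSpecialRung (h : RelSpecialRung) : JetSpecialRung :=
  jetSpecialRung_of_pinchSpecialRung (PinchCut.pinchSpecialRung_of_relSpecialRung h)

/-- **EDGE from 32107**: the tree's g10 located residual `VNSpecialRung` implies this node's. [folklore] -/
theorem jetSpecialRung_of_vnSpecialRung (h : MaxContactCut.VNSpecialRung) : JetSpecialRung :=
  jetSpecialRung_of_pinchSpecialRung (PinchCut.pinchSpecialRung_of_vnSpecialRung h)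

/-- **EDGE from 31577** (through the tree's g10 edge). [folklore] -/
theorem jetSpecialRung_of_ffSpecialRung (h : MaxContactCut.FFSpecialRung) : JetSpecialRung :=
  jetSpecialRung_of_pinchSpecialRung (PinchCut.pinchSpecialRung_of_ffSpecialRung h)

/-- **EDGE from the tree's g11 rung** `DeltaFaceCutClasses.DeltaSpecialRung`. [folklore] -/
theorem jetSpecialRung_of_deltaSpecialRung (h : DeltaSpecialRung) : JetSpecialRung :=
  jetSpecialRung_of_pinchSpecialRung (PinchCut.pinchSpecialRung_of_deltaSpecialRung h)

/-- HONESTY: modulo the decided half, g14's located residual and this node's are EQUIVALENT — both are the rung.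
[folklore] -/
theorem pinchSpecialRung_iff_jetSpecialRung (hG : JetGenericRung) : PinchSpecialRung ↔ JetSpecialRung :=
  ⟨jetSpecialRung_of_pinchSpecialRung,
    fun hS => PinchCut.pinchSpecialRung_of_rungOne (closes hG hS)⟩

/-- HONESTY: modulo the decided half, g13's located residual and this node's are EQUIVALENT. [folklore] -/
theorem leafSpecialRung_iff_jetSpecialRung (hG : JetGenericRung) : LeafSpecialRung ↔ JetSpecialRung :=
  ⟨jetSpecialRung_of_leafSpecialRung,
    fun hS => CurveLeafExit.leafSpecialRung_of_rungOne (closes hG hS)⟩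

/-- HONESTY: modulo the decided half, g12's located residual and this node's are EQUIVALENT. [folklore] -/
theorem relSpecialRung_iff_jetSpecialRung (hG : JetGenericRung) : RelSpecialRung ↔ JetSpecialRung :=
  ⟨jetSpecialRung_of_relSpecialRung,
    fun hS => (PinchCut.relSpecialRung_iff_pinchSpecialRung (pinchGenericRung_of_jetGenericRung hG)).mpr
      (PinchCut.pinchSpecialRung_of_rungOne (closes hG hS))⟩

/-- HONESTY: modulo the decided half, the tree's g10 located residual 32107 and this node's are EQUIVALENT. [folklore] -/
theorem vnSpecialRung_iff_jetSpecialRung (hG : JetGenericRung) :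
    MaxContactCut.VNSpecialRung ↔ JetSpecialRung :=
  ⟨jetSpecialRung_of_vnSpecialRung,
    fun hS => MaxContactCutVeryNearCut.nearSpecialRung_of_rungOne (closes hG hS)⟩

/-- HONESTY: modulo the decided half, the tree's g9 located residual 31577 and this node's are EQUIVALENT. [folklore] -/
theorem ffSpecialRung_iff_jetSpecialRung (hG : JetGenericRung) :
    MaxContactCut.FFSpecialRung ↔ JetSpecialRung :=
  ⟨jetSpecialRung_of_ffSpecialRung,
    fun hS => MaxContactCutFaceFormCut.specialRung_of_rungOne (closes hG hS)⟩

/-- HONESTY: modulo the decided half, the tree's g11 located residual and this node's are EQUIVALENT. [folklore] -/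
theorem deltaSpecialRung_iff_jetSpecialRung (hG : JetGenericRung) : DeltaSpecialRung ↔ JetSpecialRung :=
  ⟨jetSpecialRung_of_deltaSpecialRung,
    fun hS hE2 n hn => DeltaFaceCutKernels.seqDSpec_of_seqDimFour_one (closes hG hS hE2 n hn)⟩

/-- `RungOne` BY NAME from the decided half and g14's located residual. [folklore] -/
theorem closes_of_pinchSpecialRung (hG : JetGenericRung) (hS : PinchSpecialRung) : MaxContactCut.RungOne :=
  closes hG (jetSpecialRung_of_pinchSpecialRung hS)

/-- `RungOne` BY NAME from the decided half and g13's located residual. [folklore] -/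
theorem closes_of_leafSpecialRung (hG : JetGenericRung) (hS : LeafSpecialRung) : MaxContactCut.RungOne :=
  closes hG (jetSpecialRung_of_leafSpecialRung hS)

/-- `RungOne` BY NAME from the decided half and the tree's g10 located residual 32107. [folklore] -/
theorem closes_of_vnSpecialRung (hG : JetGenericRung) (hS : MaxContactCut.VNSpecialRung) : MaxContactCut.RungOne :=
  closes hG (jetSpecialRung_of_vnSpecialRung hS)

/-- `RungOne` BY NAME from the decided half and the tree's g9 located residual 31577. [folklore] -/
theorem closes_of_ffSpecialRung (hG : JetGenericRung) (hS : MaxContactCut.FFSpecialRung) : MaxContactCut.RungOne :=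
  closes hG (jetSpecialRung_of_ffSpecialRung hS)

/-- `RungOne` BY NAME from the decided half and the tree's g11 located residual. [folklore] -/
theorem closes_of_deltaSpecialRung (hG : JetGenericRung) (hS : DeltaSpecialRung) : MaxContactCut.RungOne :=
  closes hG (jetSpecialRung_of_deltaSpecialRung hS)

end Refinement

namespace Tame

section Kernels

variable {n : ℕ}

/-- **EXACT AT THE RUNG**: `RungOne ⟺ TameGenericRung ∧ TameSpecialRung` (marking by marking). [folklore] -/
theorem rungOne_iff : MaxContactCut.RungOne ↔ TameGenericRung ∧ TameSpecialRung := by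
  constructor
  · intro h
    exact ⟨fun hE2 n hn => seqTGen_of_seqDimFour_one (h hE2 n hn),
      fun hE2 n hn => seqTSpec_of_seqDimFour_one (h hE2 n hn)⟩
  · rintro ⟨hG, hS⟩ hE2 n hn
    exact seqDimFour_one_iff.mpr ⟨hG hE2 n hn, hS hE2 n hn⟩

/-- NECESSITY by letter: the decided half is implied by the rung. [folklore] -/
theorem tameGenericRung_of_rungOne (h : MaxContactCut.RungOne) : TameGenericRung := (rungOne_iff.mp h).1

/-- NECESSITY by letter: the located residual is implied by the rung. [folklore] -/
theorem tameSpecialRung_of_rungOne (h : MaxContactCut.RungOne) : TameSpecialRung := (rungOne_iff.mp h).2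

/-- HONESTY KERNEL: modulo the decided half, the located residual IS the rung. [folklore] -/
theorem tameSpecialRung_iff_rungOne (hG : TameGenericRung) : TameSpecialRung ↔ MaxContactCut.RungOne :=
  ⟨fun hS => rungOne_iff.mpr ⟨hG, hS⟩, tameSpecialRung_of_rungOne⟩

/-- **DECIDING IMPLICATION OF THE NODE**: `MaxContactCut.RungOne` (29273) BY NAME from the two halves. [folklore] -/
theorem closes (hG : TameGenericRung) (hS : TameSpecialRung) : MaxContactCut.RungOne :=
  rungOne_iff.mpr ⟨hG, hS⟩

/-- `RungOne` BY NAME from the eight ENGINES, the ports and the located residual. [folklore] -/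
theorem closes_of_engines (hV : VeryNearCutClasses.VeryNearExit) (hD : DeltaPackageExit)
    (hU : UniformCurvePackageExit) (hR : RelCurvePackageExit) (hN : NormalConeJumpExit)
    (hM : MonomialPinchExit) (hC : FlatConeExit) (hT : JetTameExit) (hP : ∀ n : ℕ, 2 ≤ n → CurvePackagePort n)
    (h1 : FaceFormCutClasses.OrderOneContact) (hS : TameSpecialRung) : MaxContactCut.RungOne :=
  closes (tameGenericRung_of_engines hV hD hU hR hN hM hC hT hP h1) hS

/-- **SEVEN engines suffice** — engine (T) SUBSUMES g14's engine (C) (`flatConeExit_of_jetTameExit`, PROVED): `RungOne` BY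
NAME from `VeryNearExit`, `DeltaPackageExit`, `UniformCurvePackageExit`, `RelCurvePackageExit`, `NormalConeJumpExit`,
`MonomialPinchExit`, `JetTameExit`, the ports and the located residual — NO `FlatConeExit` hypothesis. [folklore] -/
theorem closes_of_seven_engines (hV : VeryNearCutClasses.VeryNearExit) (hD : DeltaPackageExit)
    (hU : UniformCurvePackageExit) (hR : RelCurvePackageExit) (hN : NormalConeJumpExit)
    (hM : MonomialPinchExit) (hT : JetTameExit) (hP : ∀ n : ℕ, 2 ≤ n → CurvePackagePort n)
    (h1 : FaceFormCutClasses.OrderOneContact) (hS : TameSpecialRung) : MaxContactCut.RungOne :=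
  closes_of_engines hV hD hU hR hN hM (flatConeExit_of_jetTameExit hT) hT hP h1 hS

/-- `RungOne` BY NAME from the decided half and the two isolation columns. [folklore] -/
theorem closes_of_columns (hG : TameGenericRung) (hN : E 2 → ∀ n : ℕ, 1 ≤ n → SeqTSpecNonIso n)
    (hI : E 2 → ∀ n : ℕ, 1 ≤ n → SeqTSpecIso n) : MaxContactCut.RungOne :=
  closes hG (tameSpecialRung_iff_iso.mpr ⟨hN, hI⟩)

/-- `RungOne` BY NAME from the decided half and the four leaves. [folklore] -/
theorem closes_of_leaves (hG : TameGenericRung) (hR : E 2 → ∀ n : ℕ, 1 ≤ n → SeqTSpecCurveReg n)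
    (hS : E 2 → ∀ n : ℕ, 1 ≤ n → SeqTSpecCurveSing n) (hT : E 2 → ∀ n : ℕ, 1 ≤ n → SeqTSpecTangle n)
    (hI : E 2 → ∀ n : ℕ, 1 ≤ n → SeqTSpecIso n) : MaxContactCut.RungOne :=
  closes hG (tameSpecialRung_iff_leaves.mpr ⟨hR, hS, hT, hI⟩)

/-! ### Map edges BY NAME to the tree's located residuals -/

/-- MAP EDGE to the located core `MaxContactCut.StepPICoreDimFour` (28544) BY NAME, through
`MaxContactCutTauLadder.closes`. [folklore] -/
theorem closes_core (h5 : MaxContactCutExhaustion.ContactOrderSequenceDimFour) (r4 : MaxContactCut.RungFour)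
    (r3 : MaxContactCut.RungThree) (r2 : MaxContactCut.RungTwo) (hG : TameGenericRung) (hS : TameSpecialRung)
    (hSS : MaxContactCut.SequenceToStepAll) : MaxContactCut.StepPICoreDimFour :=
  (MaxContactCutTauLadder.closes h5 r4 r3 r2 (closes hG hS) hSS).2.2.2.2

/-- MAP EDGE to g7's located residual `MaxContactCut.ClosedPointCoreAll` (30461) BY NAME (given the rounds, the rung IS
the closed-point core). [folklore] -/
theorem closes_closedPointCore (hE2 : E 2) (h2 : MaxContactCut.RoundCodimTwoAll)
    (h3 : MaxContactCut.RoundCodimThreeAll) (hG : TameGenericRung) (hS : TameSpecialRung) :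
    MaxContactCut.ClosedPointCoreAll :=
  (MaxContactCutGenericPointCut.rungOne_iff_core_of_rounds hE2 h2 h3).mp (closes hG hS)

end Kernels

/-- **EXACT refinement of rev 0's residual**: given the tame decided half, `JetSpecialRung ⟺ TameSpecialRung`. [folklore] -/
theorem jetSpecialRung_iff_tameSpecialRung (hG : TameGenericRung) : JetSpecialRung ↔ TameSpecialRung :=
  ⟨tameSpecialRung_of_jetSpecialRung,
    fun hS => jetSpecialRung_of_rungOne (closes hG hS)⟩

/-- rev 0's `closes` factors through the tame cut. [folklore] -/
theorem closes_of_jetSpecialRung (hG : TameGenericRung) (hS : JetSpecialRung) : MaxContactCut.RungOne :=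
  closes hG (tameSpecialRung_of_jetSpecialRung hS)

end Tame

namespace Wide

section Kernels

variable {n : ℕ}

/-- **EXACT AT THE RUNG**: `RungOne ⟺ WideGenericRung ∧ WideSpecialRung` (marking by marking). [folklore] -/
theorem rungOne_iff : MaxContactCut.RungOne ↔ WideGenericRung ∧ WideSpecialRung := by
  constructor
  · intro h
    exact ⟨fun hE2 n hn => seqWGen_of_seqDimFour_one (h hE2 n hn),
      fun hE2 n hn => seqWSpec_of_seqDimFour_one (h hE2 n hn)⟩
  · rintro ⟨hG, hS⟩ hE2 n hn
    exact seqDimFour_one_iff.mpr ⟨hG hE2 n hn, hS hE2 n hn⟩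

/-- NECESSITY by letter: the decided half is implied by the rung. [folklore] -/
theorem wideGenericRung_of_rungOne (h : MaxContactCut.RungOne) : WideGenericRung := (rungOne_iff.mp h).1

/-- NECESSITY by letter: the located residual is implied by the rung. [folklore] -/
theorem wideSpecialRung_of_rungOne (h : MaxContactCut.RungOne) : WideSpecialRung := (rungOne_iff.mp h).2

/-- HONESTY KERNEL: modulo the decided half, the located residual IS the rung. [folklore] -/
theorem wideSpecialRung_iff_rungOne (hG : WideGenericRung) : WideSpecialRung ↔ MaxContactCut.RungOne :=
  ⟨fun hS => rungOne_iff.mpr ⟨hG, hS⟩, wideSpecialRung_of_rungOne⟩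

/-- **DECIDING IMPLICATION OF THE NODE**: `MaxContactCut.RungOne` (29273) BY NAME from the two halves. [folklore] -/
theorem closes (hG : WideGenericRung) (hS : WideSpecialRung) : MaxContactCut.RungOne :=
  rungOne_iff.mpr ⟨hG, hS⟩

/-- `RungOne` BY NAME from the eight ENGINES, the ports and the located residual. [folklore] -/
theorem closes_of_engines (hV : VeryNearCutClasses.VeryNearExit) (hD : DeltaPackageExit)
    (hU : UniformCurvePackageExit) (hR : RelCurvePackageExit) (hN : NormalConeJumpExit)
    (hM : MonomialPinchExit) (hC : FlatConeExit) (hW : WideExit) (hP : ∀ n : ℕ, 2 ≤ n → CurvePackagePort n)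
    (h1 : FaceFormCutClasses.OrderOneContact) (hS : WideSpecialRung) : MaxContactCut.RungOne :=
  closes (wideGenericRung_of_engines hV hD hU hR hN hM hC hW hP h1) hS

/-- **SEVEN engines suffice** — engine (W) SUBSUMES g14's engine (C) (`flatConeExit_of_wideExit`, PROVED): `RungOne` BY
NAME from `VeryNearExit`, `DeltaPackageExit`, `UniformCurvePackageExit`, `RelCurvePackageExit`, `NormalConeJumpExit`,
`MonomialPinchExit`, `WideExit`, the ports and the located residual — NO `FlatConeExit` hypothesis. [folklore] -/
theorem closes_of_seven_engines (hV : VeryNearCutClasses.VeryNearExit) (hD : DeltaPackageExit)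
    (hU : UniformCurvePackageExit) (hR : RelCurvePackageExit) (hN : NormalConeJumpExit)
    (hM : MonomialPinchExit) (hW : WideExit) (hP : ∀ n : ℕ, 2 ≤ n → CurvePackagePort n)
    (h1 : FaceFormCutClasses.OrderOneContact) (hS : WideSpecialRung) : MaxContactCut.RungOne :=
  closes_of_engines hV hD hU hR hN hM (flatConeExit_of_wideExit hW) hW hP h1 hS

/-- `RungOne` BY NAME from the decided half and the two isolation columns. [folklore] -/
theorem closes_of_columns (hG : WideGenericRung) (hN : E 2 → ∀ n : ℕ, 1 ≤ n → SeqWSpecNonIso n)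
    (hI : E 2 → ∀ n : ℕ, 1 ≤ n → SeqWSpecIso n) : MaxContactCut.RungOne :=
  closes hG (wideSpecialRung_iff_iso.mpr ⟨hN, hI⟩)

/-- `RungOne` BY NAME from the decided half and the four leaves. [folklore] -/
theorem closes_of_leaves (hG : WideGenericRung) (hR : E 2 → ∀ n : ℕ, 1 ≤ n → SeqWSpecCurveReg n)
    (hS : E 2 → ∀ n : ℕ, 1 ≤ n → SeqWSpecCurveSing n) (hT : E 2 → ∀ n : ℕ, 1 ≤ n → SeqWSpecTangle n)
    (hI : E 2 → ∀ n : ℕ, 1 ≤ n → SeqWSpecIso n) : MaxContactCut.RungOne :=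
  closes hG (wideSpecialRung_iff_leaves.mpr ⟨hR, hS, hT, hI⟩)

end Kernels

end Wide

end Summit.ResolutionOfSingularities.ResolutionOfSingularities.Theorems.JetCut
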